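import Literature.MathematicalPhysics.QuantumFieldTheory.Balaban1983to89.B9Eq316TowerFlatIsOneStep
import Literature.MathematicalPhysics.QuantumFieldTheory.Balaban1983to89.B5Eq190FlatStrongFormTransfer
import Literature.MathematicalPhysics.QuantumFieldTheory.Balaban1983to89.B9Eq323FlatBlockPoincare

/-!
# `Balaban1983to89.B9Eq326OperatorTowerFlatExplicit` — T. Bałaban, *Propagators and renormalization transformations for lattice gauge theories. I*,
# Commun. Math. Phys. **95** (1984) 17–40 [Balaban1984PropagatorsI] Prop. 1.1 (1.90) p. 33 «γ₀ independent of k», and *Propagators for lattice gauge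
# theories in a background field*, Commun. Math. Phys. **99** (1985) 389–434 [Balaban1985BackgroundPropagators] (3.21)–(3.26) pp. 394–395, Thm 3.11
# p. 416 AT THE FLAT BACKGROUND FOR THE `(n+1)`-LEVEL OPERATOR: **THE TWO FLAT CONSTANTS OF THE TOWER, EXPLICIT** — the STRONG flat coercivity
# `γ(d,a″)·(‖D(1)x‖² + ‖D*(1)x‖² + (ηL^{n+1})⁻²‖x‖²) ≤ re⟨x, (D*D + D R_{n+1}(1) D* + aQ_{n+1}(1)†Q_{n+1}(1)) x⟩` (`γ(d,a) = 1∕((d+1)·Cst d a)` along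
# print's normalisation — free of `m, L, η, c₀, c₁` AND of the number of levels) and the flat modulus `(2∕((L^{n+1})²η²))·‖λ‖ ≤ ‖Δ^η_1 λ‖` on `N(Q′_{n+1}(1))`

statement-level skeleton of published theorems with citation tags; proofs where landed; nothing here is a claim about the Yang–Mills mass gap

PDF held: `paper:balaban1984-cmp95-propagators-rt-i` p. 33 and `paper:balaban1985-cmp99-background-propagators` pp. 393–395, 416 through the tree's
`B5Eq190FlatStrongFormTransfer` ∕ `B9Eq323FlatBlockPoincare` ∕ `B9Eq326OperatorTower` docstrings (verbatim there).
THE PRINT (verbatim, [B5] p. 33).  *«Proposition 1.1. … with a positive constant γ₀ independent of k, T_η, and depending on d only (if we put a = 1).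
This implies the bound from below: Δ_a = G⁻¹ ≥ γ₀(Δ + I). (1.90)»* — `k` is the number of averaging steps composed into `Q_k` ((1.17)–(1.18) p. 20).

WHY THIS FILE (cell context: `TOWER-SPECIES-PLAN.md` v2 §3, the NON-UNIFORMITY LEDGER of the pub-balaban NE9 tower chain).  Of the three compactness
constants of the gen-83 `k`-level chain — `γ₀` (`B9Eq326OperatorTowerFlat.exists_coercive_principalk_one`), `μ_{1,k}`
(`B9Thm311SmallFieldCoercivityTower.exists_flat_modulus_tower`), `μ_{Q1,k}` — the last was made explicit by `B9Eq315QTowerFlatRightInverse`; THIS FILE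
makes the first two explicit, by porting the ONE-STEP theorems that hold for every block size — ne9-leaf-03's S0 `B5Eq190FlatStrongFormTransfer`
(b05's kernel-certified (1.90) `B5Prop11Lower.form_LapOne_le` with all its rows) and ne9-leaf-04's `B9Eq323FlatBlockPoincare.flat_modulus_explicit` — to
block size `L^{n+1}` along `B9Eq316TowerFlatIsOneStep` (the flat `(n+1)`-level letters ARE the one-step letters at block size `L^{n+1}`; the casts are
isometries intertwining `D`, `D*`, `Δ^η_1` and the principal operator).

WHAT IS PROVED (sorry-free; 0 `def`; nothing of the papers asserted — (1.90) enters as the tree THEOREM `B5Prop11Lower.form_LapOne_le` via S0).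
* §1 **`flat_strong_coercive_tower`**: `γ(d,a″)·(‖D(1)x‖² + ‖D*(1)x‖² + (ηL^{n+1})⁻²‖x‖²) ≤ re⟨x, Δ^{(n+1)}_{prin}(1)x⟩` on `BondL2K ℂ d (towerP L m (n+1)) c₀ W`,
  `a″ = a·c₁·(ηL^{n+1})²∕(c₀L^{(n+1)d})`, for ANY displayed tower data; **`flat_strong_coercive_tower_canonical`**: along `c₁·(ηL^{n+1})² = c₀·L^{(n+1)d}`,
  `0 < ηL^{n+1} ≤ 1`, the constant is `γ(d,a)`; **`flat_strong_coercive_tower_linear`** (`γ(d,1)·min(a″,1)`, ne9-leaf-04's (F″) order);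
  **`coercive_principalk_one_explicit`** ∕ **`coercive_laplaceAk_one_explicit`** — the WEAK row `γ(d,a″)(ηL^{n+1})⁻²·‖x‖² ≤ re⟨x, Δ_a(1)x⟩` with its explicit
  constant: the drop-in for the compactness `γ` of `exists_coercive_principalk_one` ∕ `exists_coercive_laplaceAk_one` (the `hpos`∕`hγ` letter of
  `Support/NE9CurChartTower` at `U := 1`); **`exists_strong_coercive_flat_tower_canonical`**: `∃ γ > 0` BEFORE `∀ L ∀ n ∀ η ∀ c₀ c₁ ∀ m` — ONE constant
  for EVERY number of levels (flat tower data inhabited at the profile `α := 0`, `B9Eq315QTowerFlat`).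
* §2 **`flat_modulus_tower_explicit`**: `Q′_{n+1}(1)λ = 0 ⇒ (2∕((L^{n+1})²η²))·‖λ‖ ≤ ‖Δ^η_1 λ‖`; `exists_flat_modulus_tower_explicit` (the `∃ μ` statement of
  `exists_flat_modulus_tower` with the witness named) — `= 2` on the diagonal `ηL^{n+1} = 1`.
MODEL ∕ DECLARED READINGS.  (M1) as `B5Eq190FlatStrongFormTransfer` one storey up: the `(n+1)`-level torus `T_{L^{n+1}m}` IS the one-step fine torus with
block size `L^{n+1}` over `T_m` (`towerP_eq_fineP_pow`); fine weight `c₀`, unit-lattice weight `c₁`, scalar `η⁻¹`; the `(ηL^{n+1})⁻²` on the mass row is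
the block-side rescaling (b05's derivative scale is the block size).  (M2) no hypothesis of the papers displayed: `η ≠ 0`, `0 < a`, `1 ≤ L` (§1
canonical: `0 < ηL^{n+1} ≤ 1` and the weight relation DISPLAYED).  (M3) NOT HERE: anything at `U ≠ 1` — the small-field `(n+1)`-level coercivity of
`B9Thm311SmallFieldCoercivityTower` still consumes the TELESCOPED tower letters `ρ′_k`, `δ_{Q,k}` and the averaged smallness `ε̄_k` (exponential in `k`
from level-`0` bonds; print's (3.35)–(3.37) running windows are their `k`-free source — not this file); the `(117)`-currency `√#bonds` of
`B9Eq3126H1BoundTower` §4; decay ([B9] Thms 3.12∕3.13).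
HONEST SCOPE.  ONE printed inequality ([B5] (1.90), kernel-certified on b05's carrier) and one [folklore] block Poincaré inequality, both already in the
tree at every block size, transported to the `(n+1)`-level letters by isometric re-typing; flat background only; «NE9 ⇐ the named binders»; NE9 NOT
PRINTED ∕ NOT PROVED; NOT summit progress (cell pub-balaban: row NE9 WALLED ON A MODEL; spine PROVED 0∕9; rung (B)+1 finite T⁴ — NOT infinite volume,
NOT mass gap, NOT Clay; HONEST DEPENDENCY: continuum YM on T⁴ ⇐ BetaPertH ∧ nine spine estimates (0/9 proved); BetaPertH ⇐ (D1) ∧ (D4) ∧ CAP+tail;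
G-an2-4 gates asym, D1 and NE2/3/4).  Filed by the pub-balaban NE9 BINDER-row owner lineage `b2b-balaban-t4-ne9-p1` (gen 84), INTENT I-ne9p1-g84-2;
NEW file importing `B9Eq316TowerFlatIsOneStep`, `B5Eq190FlatStrongFormTransfer`, `B9Eq323FlatBlockPoincare`; modifies nothing.  Net new unproved facts: 0.
-/

noncomputable section

open scoped InnerProductSpace ComplexConjugate BigOperators

namespace Literature.MathematicalPhysics.QuantumFieldTheory.Balaban1983to89.B9Eq326OperatorTowerFlatExplicit

open B4Sect5Torus (TSite)
open B9SectCLatticeCarrier (Bond)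
open B7Prop1Explicit (U1 Wcx boxVec)
open B9Eq311L2Pairing (WL2)
open B9Eq319QprimeTorus (fineP)
open B9Eq315QTorus (perCfg cornerSite QtorusW)
open B9Eq315QTower (towerP UlevOf)
open B9Eq326OperatorAssembly (QprimeW RofU)
open B9Eq326OperatorTower (QprimeTowerW QkW RofUk laplaceAk)
open B9Eq310HessianOperator (adTransportW principalOpK covCurlL2K hessOp hessOp_one)
open B11Eq103H1Complex (SiteL2K BondL2K covDerivL2K covDivL2K covLaplaceSiteK laplaceALatticeK RLatticeK)
open B5Eq172FlatCoercivity (hU1_one hreg_one)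
open B5Eq190FlatStrongFormTransfer (flat_strong_coercive_uniform flat_strong_coercive_canonical flat_strong_coercive_linear)
open B9Eq323FlatBlockPoincare (flat_modulus_explicit)
open B9Eq316TowerFlatIsOneStep (towerP_eq_fineP_pow siteL2Cast bondL2Cast norm_bondL2Cast norm_siteL2Cast norm_covCurlL2K_one_bondL2Cast
  norm_covDivL2K_inv_one_bondL2Cast covLaplaceSiteK_one_siteL2Cast inner_principalLaplacek_one_eq_oneStep QprimeTowerW_one_eq_zero_iff)

variable {d : ℕ}

/-! ## §1 γ₀ of the `(n+1)`-level flat principal operator, EXPLICIT: [B5] (1.90) one storey up -/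

section Strong

variable {𝔸 : Type*} [NormedRing 𝔸] [NormedAlgebra ℂ 𝔸] [CompleteSpace 𝔸] [NormOneClass 𝔸]
  (L : ℕ) [NeZero L] (m : Fin d → ℕ) [∀ i, NeZero (m i)] (n : ℕ) (hL : 1 ≤ L)
  {W : Type*} [NormedAddCommGroup W] [InnerProductSpace ℂ W] [FiniteDimensional ℂ W] (φ : W ≃ₗ[ℂ] 𝔸) {c₀ c₁ : ℝ}
  [Fact (0 < c₀)] [Fact (0 < c₁)]
  (α : ℕ → ℝ) (hα1 : ∀ j, α j ≤ 1 / 64)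
  (hU1 : ∀ (j : ℕ) (x : B7Prop1Explicit.Site d) (κ : Fin d),
    perCfg (towerP L m (j + 1)) (UlevOf L m (n + 1) (fun _ : Bond d (towerP L m (n + 1)) => (1 : 𝔸ˣ)) j) x κ ∈ U1 𝔸)
  (hreg : ∀ (j : ℕ) (y : TSite d (towerP L m j)) (κ : Fin d) (r : Fin d → Fin L),
    ‖((Wcx L (perCfg (towerP L m (j + 1)) (UlevOf L m (n + 1) (fun _ : Bond d (towerP L m (n + 1)) => (1 : 𝔸ˣ)) j)) (cornerSite L y) κ
      (boxVec L r) : 𝔸ˣ) : 𝔸) - 1‖ ≤ α j)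
  {η : ℝ} (hη : η ≠ 0) {a : ℝ} (ha : 0 < a)

include hL hη ha

/-- **[B5] PROP. 1.1 (1.90) WITH ITS GRADIENT ROWS FOR THE `(n+1)`-LEVEL FLAT PRINCIPAL GAUGE-FIXED OPERATOR — THE STRONG FLAT FORM OF THE
TOWER, EXPLICIT**: `γ(d,a″)·(‖D(1)x‖² + ‖D*(1)x‖² + (ηL^{n+1})⁻²‖x‖²) ≤ re⟨x, (D*D + D R_{n+1}(1) D* + aQ_{n+1}(1)†Q_{n+1}(1)) x⟩` with
`a″ = a·c₁·(ηL^{n+1})²∕(c₀L^{(n+1)d})`, `γ(d,a) = 1∕((d+1)·Cst d a)` — ne9-leaf-03's S0 `B5Eq190FlatStrongFormTransfer.flat_strong_coercive_uniform` AT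
BLOCK SIZE `L^{n+1}` carried to the tower letters by `B9Eq316TowerFlatIsOneStep` (the flat `(n+1)`-level letters ARE the one-step letters at block
size `L^{n+1}`); replaces the compactness constant of `B9Eq326OperatorTowerFlat.exists_coercive_principalk_one` by print's «γ₀ independent of k».
[cite: Balaban1984PropagatorsI, Prop. 1.1 (1.90) p.33, (1.69) p.29, (1.18) p.20; Balaban1985BackgroundPropagators, (3.26) p.395, (3.15)–(3.16) p.393, Thm 3.11 p.416] -/
theorem flat_strong_coercive_tower (x : BondL2K ℂ d (towerP L m (n + 1)) c₀ W) :
    (1 / ((d + 1 : ℝ) * B5Prop11Plancherel.Cst d (a * c₁ * (η * (L : ℝ) ^ (n + 1)) ^ 2 / (c₀ * ((L : ℝ) ^ (n + 1)) ^ d)))) *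
        (‖covCurlL2K ℂ c₀ ((η : ℂ))⁻¹ (adTransportW φ (fun _ : Bond d (towerP L m (n + 1)) => (1 : 𝔸ˣ))) x‖ ^ 2 +
          ‖covDivL2K ℂ c₀ ((η : ℂ))⁻¹ (adTransportW φ fun _ : Bond d (towerP L m (n + 1)) => (1 : 𝔸ˣ)⁻¹) x‖ ^ 2 +
          ((η * (L : ℝ) ^ (n + 1))⁻¹) ^ 2 * ‖x‖ ^ 2) ≤
      RCLike.re ⟪x, laplaceALatticeK ((η : ℂ))⁻¹ (adTransportW φ (fun _ : Bond d (towerP L m (n + 1)) => (1 : 𝔸ˣ)))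
        (adTransportW φ fun _ : Bond d (towerP L m (n + 1)) => (1 : 𝔸ˣ)⁻¹) (principalOpK φ η fun _ => 1)
        (RofUk L m n φ η fun _ : Bond d (towerP L m (n + 1)) => (1 : 𝔸ˣ))
        (QkW L m n φ (fun _ : Bond d (towerP L m (n + 1)) => (1 : 𝔸ˣ)) hL α hα1 hU1 hreg (c₁ := c₁)) a x⟫_ℂ := by
  have h := towerP_eq_fineP_pow L m (n + 1)
  have hLk : 1 ≤ L ^ (n + 1) := Nat.one_le_pow _ _ (by omega)
  have key := flat_strong_coercive_uniform (L ^ (n + 1)) m hLk φ (c₁ := c₁) (show (0 : ℝ) ≤ 1 / 64 by norm_num)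
    (hU1_one (L ^ (n + 1)) m) (hreg_one (L ^ (n + 1)) m) hη ha (bondL2Cast ℂ h x)
  rw [norm_covCurlL2K_one_bondL2Cast, norm_covDivL2K_inv_one_bondL2Cast, norm_bondL2Cast,
    inner_principalLaplacek_one_eq_oneStep L m n hL φ η α hα1 hU1 hreg hLk _ (hU1_one _ m) (hreg_one _ m) h a x] at key
  simpa only [Nat.cast_pow] using key

omit hη in
/-- **ALONG BAŁABAN's NORMALISATION `c₁·(ηL^{n+1})² = c₀·L^{(n+1)d}`, BLOCKS OF SIDE `0 < ηL^{n+1} ≤ 1`, THE STRONG CONSTANT OF THE TOWER IS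
`γ(d,a)` — FREE OF `m, L, η, c₀, c₁` AND OF THE NUMBER OF LEVELS `n+1`** (print: «γ₀ independent of k, T_η, and depending on d only»): S0's
`flat_strong_coercive_canonical` one storey up. [cite: Balaban1984PropagatorsI, Prop. 1.1 (1.90) p.33, (1.18) p.20; Balaban1985BackgroundPropagators, (3.16) p.393, (3.26) p.395, Thm 3.11 p.416] -/
theorem flat_strong_coercive_tower_canonical (hηL0 : 0 < η * (L : ℝ) ^ (n + 1)) (hηL1 : η * (L : ℝ) ^ (n + 1) ≤ 1)
    (hs : c₁ * (η * (L : ℝ) ^ (n + 1)) ^ 2 = c₀ * ((L : ℝ) ^ (n + 1)) ^ d) (x : BondL2K ℂ d (towerP L m (n + 1)) c₀ W) :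
    (1 / ((d + 1 : ℝ) * B5Prop11Plancherel.Cst d a)) *
        (‖covCurlL2K ℂ c₀ ((η : ℂ))⁻¹ (adTransportW φ (fun _ : Bond d (towerP L m (n + 1)) => (1 : 𝔸ˣ))) x‖ ^ 2 +
          ‖covDivL2K ℂ c₀ ((η : ℂ))⁻¹ (adTransportW φ fun _ : Bond d (towerP L m (n + 1)) => (1 : 𝔸ˣ)⁻¹) x‖ ^ 2 + ‖x‖ ^ 2) ≤
      RCLike.re ⟪x, laplaceALatticeK ((η : ℂ))⁻¹ (adTransportW φ (fun _ : Bond d (towerP L m (n + 1)) => (1 : 𝔸ˣ)))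
        (adTransportW φ fun _ : Bond d (towerP L m (n + 1)) => (1 : 𝔸ˣ)⁻¹) (principalOpK φ η fun _ => 1)
        (RofUk L m n φ η fun _ : Bond d (towerP L m (n + 1)) => (1 : 𝔸ˣ))
        (QkW L m n φ (fun _ : Bond d (towerP L m (n + 1)) => (1 : 𝔸ˣ)) hL α hα1 hU1 hreg (c₁ := c₁)) a x⟫_ℂ := by
  have h := towerP_eq_fineP_pow L m (n + 1)
  have hLk : 1 ≤ L ^ (n + 1) := Nat.one_le_pow _ _ (by omega)
  have hηL0' : 0 < η * ((L ^ (n + 1) : ℕ) : ℝ) := by simpa only [Nat.cast_pow] using hηL0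
  have hηL1' : η * ((L ^ (n + 1) : ℕ) : ℝ) ≤ 1 := by simpa only [Nat.cast_pow] using hηL1
  have hs' : c₁ * (η * ((L ^ (n + 1) : ℕ) : ℝ)) ^ 2 = c₀ * (((L ^ (n + 1) : ℕ) : ℝ)) ^ d := by simpa only [Nat.cast_pow] using hs
  have key := flat_strong_coercive_canonical (L ^ (n + 1)) m hLk φ (c₁ := c₁) (show (0 : ℝ) ≤ 1 / 64 by norm_num)
    (hU1_one (L ^ (n + 1)) m) (hreg_one (L ^ (n + 1)) m) ha hηL0' hηL1' hs' (bondL2Cast ℂ h x)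
  rwa [norm_covCurlL2K_one_bondL2Cast, norm_covDivL2K_inv_one_bondL2Cast, norm_bondL2Cast,
    inner_principalLaplacek_one_eq_oneStep L m n hL φ η α hα1 hU1 hreg hLk _ (hU1_one _ m) (hreg_one _ m) h a x] at key

/-- **THE LINEAR CONSTANT one storey up** (ne9-leaf-04's (F″) device through S0's `flat_strong_coercive_linear`): `(γ(d,1)·min(a″,1))·(‖D(1)x‖² +
‖D*(1)x‖² + (ηL^{n+1})⁻²‖x‖²) ≤ re⟨x, Δ^{(n+1)}_{prin}(1)x⟩` — the right small-`a` order. [cite: Balaban1984PropagatorsI, Prop. 1.1 (1.90) p.33, (1.18) p.20; Balaban1983RegularityDecay, (2.27) p.580; Balaban1985BackgroundPropagators, (3.26) p.395] -/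
theorem flat_strong_coercive_tower_linear (x : BondL2K ℂ d (towerP L m (n + 1)) c₀ W) :
    (1 / ((d + 1 : ℝ) * B5Prop11Plancherel.Cst d 1)) * min (a * c₁ * (η * (L : ℝ) ^ (n + 1)) ^ 2 / (c₀ * ((L : ℝ) ^ (n + 1)) ^ d)) 1 *
        (‖covCurlL2K ℂ c₀ ((η : ℂ))⁻¹ (adTransportW φ (fun _ : Bond d (towerP L m (n + 1)) => (1 : 𝔸ˣ))) x‖ ^ 2 +
          ‖covDivL2K ℂ c₀ ((η : ℂ))⁻¹ (adTransportW φ fun _ : Bond d (towerP L m (n + 1)) => (1 : 𝔸ˣ)⁻¹) x‖ ^ 2 +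
          ((η * (L : ℝ) ^ (n + 1))⁻¹) ^ 2 * ‖x‖ ^ 2) ≤
      RCLike.re ⟪x, laplaceALatticeK ((η : ℂ))⁻¹ (adTransportW φ (fun _ : Bond d (towerP L m (n + 1)) => (1 : 𝔸ˣ)))
        (adTransportW φ fun _ : Bond d (towerP L m (n + 1)) => (1 : 𝔸ˣ)⁻¹) (principalOpK φ η fun _ => 1)
        (RofUk L m n φ η fun _ : Bond d (towerP L m (n + 1)) => (1 : 𝔸ˣ))
        (QkW L m n φ (fun _ : Bond d (towerP L m (n + 1)) => (1 : 𝔸ˣ)) hL α hα1 hU1 hreg (c₁ := c₁)) a x⟫_ℂ := by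
  have h := towerP_eq_fineP_pow L m (n + 1)
  have hLk : 1 ≤ L ^ (n + 1) := Nat.one_le_pow _ _ (by omega)
  have key := flat_strong_coercive_linear (L ^ (n + 1)) m hLk φ (c₁ := c₁) (show (0 : ℝ) ≤ 1 / 64 by norm_num)
    (hU1_one (L ^ (n + 1)) m) (hreg_one (L ^ (n + 1)) m) hη ha (bondL2Cast ℂ h x)
  rw [norm_covCurlL2K_one_bondL2Cast, norm_covDivL2K_inv_one_bondL2Cast, norm_bondL2Cast,
    inner_principalLaplacek_one_eq_oneStep L m n hL φ η α hα1 hU1 hreg hLk _ (hU1_one _ m) (hreg_one _ m) h a x] at key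
  simpa only [Nat.cast_pow] using key

/-- **THE WEAK ROW WITH ITS EXPLICIT CONSTANT** — the drop-in for `B9Eq326OperatorTowerFlat.exists_coercive_principalk_one`'s compactness `γ`:
`γ(d,a″)·(ηL^{n+1})⁻²·‖x‖² ≤ re⟨x, Δ^{(n+1)}_{prin}(1)x⟩`. [cite: Balaban1984PropagatorsI, Prop. 1.1 (1.90) p.33, (1.72) p.30; Balaban1985BackgroundPropagators, (3.26) p.395, Thm 3.11 p.416] -/
theorem coercive_principalk_one_explicit (x : BondL2K ℂ d (towerP L m (n + 1)) c₀ W) :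
    (1 / ((d + 1 : ℝ) * B5Prop11Plancherel.Cst d (a * c₁ * (η * (L : ℝ) ^ (n + 1)) ^ 2 / (c₀ * ((L : ℝ) ^ (n + 1)) ^ d)))) *
        ((η * (L : ℝ) ^ (n + 1))⁻¹) ^ 2 * ‖x‖ ^ 2 ≤
      RCLike.re ⟪x, laplaceALatticeK ((η : ℂ))⁻¹ (adTransportW φ (fun _ : Bond d (towerP L m (n + 1)) => (1 : 𝔸ˣ)))
        (adTransportW φ fun _ : Bond d (towerP L m (n + 1)) => (1 : 𝔸ˣ)⁻¹) (principalOpK φ η fun _ => 1)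
        (RofUk L m n φ η fun _ : Bond d (towerP L m (n + 1)) => (1 : 𝔸ˣ))
        (QkW L m n φ (fun _ : Bond d (towerP L m (n + 1)) => (1 : 𝔸ˣ)) hL α hα1 hU1 hreg (c₁ := c₁)) a x⟫_ℂ := by
  have key := flat_strong_coercive_tower L m n hL φ (c₁ := c₁) α hα1 hU1 hreg hη ha x
  have hC : (1 : ℝ) ≤ B5Prop11Plancherel.Cst d (a * c₁ * (η * (L : ℝ) ^ (n + 1)) ^ 2 / (c₀ * ((L : ℝ) ^ (n + 1)) ^ d)) :=
    B5Prop11Lower.one_le_Cst _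
  have hγ : 0 ≤ 1 / ((d + 1 : ℝ) * B5Prop11Plancherel.Cst d (a * c₁ * (η * (L : ℝ) ^ (n + 1)) ^ 2 / (c₀ * ((L : ℝ) ^ (n + 1)) ^ d))) := by
    positivity
  have hdrop : ((η * (L : ℝ) ^ (n + 1))⁻¹) ^ 2 * ‖x‖ ^ 2 ≤
      ‖covCurlL2K ℂ c₀ ((η : ℂ))⁻¹ (adTransportW φ (fun _ : Bond d (towerP L m (n + 1)) => (1 : 𝔸ˣ))) x‖ ^ 2 +
        ‖covDivL2K ℂ c₀ ((η : ℂ))⁻¹ (adTransportW φ fun _ : Bond d (towerP L m (n + 1)) => (1 : 𝔸ˣ)⁻¹) x‖ ^ 2 +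
        ((η * (L : ℝ) ^ (n + 1))⁻¹) ^ 2 * ‖x‖ ^ 2 := by
    nlinarith [sq_nonneg ‖covCurlL2K ℂ c₀ ((η : ℂ))⁻¹ (adTransportW φ (fun _ : Bond d (towerP L m (n + 1)) => (1 : 𝔸ˣ))) x‖,
      sq_nonneg ‖covDivL2K ℂ c₀ ((η : ℂ))⁻¹ (adTransportW φ fun _ : Bond d (towerP L m (n + 1)) => (1 : 𝔸ˣ)⁻¹) x‖]
  calc _ = (1 / ((d + 1 : ℝ) * B5Prop11Plancherel.Cst d (a * c₁ * (η * (L : ℝ) ^ (n + 1)) ^ 2 / (c₀ * ((L : ℝ) ^ (n + 1)) ^ d)))) *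
        (((η * (L : ℝ) ^ (n + 1))⁻¹) ^ 2 * ‖x‖ ^ 2) := by ring
    _ ≤ _ := (mul_le_mul_of_nonneg_left hdrop hγ).trans key

variable [StarRing 𝔸] [StarModule ℂ 𝔸] (τ : 𝔸 →ₗ[ℂ] ℂ)

/-- **THE SAME FOR [B9] (3.26)'s `Δ_a(1)` AT `n+1` LEVELS** (`laplaceAk … 1`; at the flat background the Hessian IS its principal part, `hessOp_one`):
the `hpos`∕`hγ` letter of `Support/NE9CurChartTower` at `U := 1` with an EXPLICIT constant. [cite: Balaban1985BackgroundPropagators, (3.26) p.395, (3.10) p.392, Thm 3.11 p.416; Balaban1984PropagatorsI, Prop. 1.1 (1.90) p.33] -/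
theorem coercive_laplaceAk_one_explicit (x : BondL2K ℂ d (towerP L m (n + 1)) c₀ W) :
    (1 / ((d + 1 : ℝ) * B5Prop11Plancherel.Cst d (a * c₁ * (η * (L : ℝ) ^ (n + 1)) ^ 2 / (c₀ * ((L : ℝ) ^ (n + 1)) ^ d)))) *
        ((η * (L : ℝ) ^ (n + 1))⁻¹) ^ 2 * ‖x‖ ^ 2 ≤
      RCLike.re ⟪x, laplaceAk L m n φ η (fun _ : Bond d (towerP L m (n + 1)) => (1 : 𝔸ˣ)) hL α hα1 hU1 hreg τ (c₀ := c₀) (c₁ := c₁) a x⟫_ℂ := by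
  rw [laplaceAk, hessOp_one]
  exact coercive_principalk_one_explicit L m n hL φ α hα1 hU1 hreg hη ha x

/-- **THE SHAPE OF [B9] THM 3.11's SECOND HALF AT `n+1` LEVELS WITH THE FLAT CONSTANT EXPLICIT** — the twin of
`B9Eq326OperatorTowerFlat.exists_coercive_laplaceAk_of_near_flat` without its `∃ γ₀`: every operator `T` with `‖(T − Δ_a(1))x‖ ≤ δ‖x‖` is
`(γ(d,a″)(ηL^{n+1})⁻² − δ)`-coercive (`B5Eq172HodgePositivity.coercive_of_sub_le`). [cite: Balaban1985BackgroundPropagators, Thm 3.11 p.416, (3.86) p.407; Balaban1984PropagatorsI, Prop. 1.1 (1.90) p.33] -/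
theorem coercive_laplaceAk_of_near_flat_explicit (T : BondL2K ℂ d (towerP L m (n + 1)) c₀ W →ₗ[ℂ] BondL2K ℂ d (towerP L m (n + 1)) c₀ W) {δ : ℝ}
    (hT : ∀ x, ‖T x - laplaceAk L m n φ η (fun _ : Bond d (towerP L m (n + 1)) => (1 : 𝔸ˣ)) hL α hα1 hU1 hreg τ (c₀ := c₀) (c₁ := c₁) a x‖ ≤ δ * ‖x‖)
    (x : BondL2K ℂ d (towerP L m (n + 1)) c₀ W) :
    ((1 / ((d + 1 : ℝ) * B5Prop11Plancherel.Cst d (a * c₁ * (η * (L : ℝ) ^ (n + 1)) ^ 2 / (c₀ * ((L : ℝ) ^ (n + 1)) ^ d)))) *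
        ((η * (L : ℝ) ^ (n + 1))⁻¹) ^ 2 - δ) * ‖x‖ ^ 2 ≤ RCLike.re ⟪x, T x⟫_ℂ :=
  B5Eq172HodgePositivity.coercive_of_sub_le (fun y => coercive_laplaceAk_one_explicit L m n hL φ (c₁ := c₁) α hα1 hU1 hreg hη ha τ y) hT x

end Strong

section CanonicalExists

open B9Eq315QTowerFlat (perCfg_UlevOf_one_mem_U1 norm_Wcx_UlevOf_one_sub_one_le)

variable {𝔸 : Type*} [NormedRing 𝔸] [NormedAlgebra ℂ 𝔸] [CompleteSpace 𝔸] [NormOneClass 𝔸]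
  {W : Type*} [NormedAddCommGroup W] [InnerProductSpace ℂ W] [FiniteDimensional ℂ W] (φ : W ≃ₗ[ℂ] 𝔸) {a : ℝ} (ha : 0 < a)

include ha

/-- **`∃ γ` BEFORE `∀ L ∀ n ∀ η ∀ c₀ c₁ ∀ m` — ONE FLAT CONSTANT FOR EVERY NUMBER OF LEVELS**: print's «γ₀ independent of k, T_η, and depending
on d only» for the `(n+1)`-LEVEL principal gauge-fixed operator `D*D + D R_{n+1}(1) D* + aQ_{n+1}(1)†Q_{n+1}(1)` of [B9] (3.26) with the COMPOSITE
averagings (3.15)∕(3.19), in Hodge shape, along the normalisation `c₁·(ηL^{n+1})² = c₀·L^{(n+1)d}` with blocks of side `0 < ηL^{n+1} ≤ 1` (the flat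
tower data inhabited at the profile `α := 0`, `B9Eq315QTowerFlat`).  This REPLACES the per-lattice, per-`k` compactness constant of
`B9Eq326OperatorTowerFlat.exists_coercive_principalk_one`. [cite: Balaban1984PropagatorsI, Prop. 1.1 (1.90) p.33, (1.18) p.20; Balaban1985BackgroundPropagators, (3.15)–(3.16) p.393, (3.26) p.395, Thm 3.11 p.416] -/
theorem exists_strong_coercive_flat_tower_canonical :
    ∃ γ : ℝ, 0 < γ ∧ ∀ (L : ℕ) [NeZero L] (hL : 1 ≤ L) (n : ℕ) (η : ℝ), 0 < η * (L : ℝ) ^ (n + 1) → η * (L : ℝ) ^ (n + 1) ≤ 1 →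
      ∀ (c₀ c₁ : ℝ) [Fact (0 < c₀)] [Fact (0 < c₁)], c₁ * (η * (L : ℝ) ^ (n + 1)) ^ 2 = c₀ * ((L : ℝ) ^ (n + 1)) ^ d →
      ∀ (m : Fin d → ℕ) [∀ i, NeZero (m i)] (x : BondL2K ℂ d (towerP L m (n + 1)) c₀ W),
      γ * (‖covCurlL2K ℂ c₀ ((η : ℂ))⁻¹ (adTransportW φ (fun _ : Bond d (towerP L m (n + 1)) => (1 : 𝔸ˣ))) x‖ ^ 2 +
            ‖covDivL2K ℂ c₀ ((η : ℂ))⁻¹ (adTransportW φ fun _ : Bond d (towerP L m (n + 1)) => (1 : 𝔸ˣ)⁻¹) x‖ ^ 2 + ‖x‖ ^ 2) ≤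
        RCLike.re ⟪x, laplaceALatticeK ((η : ℂ))⁻¹ (adTransportW φ (fun _ : Bond d (towerP L m (n + 1)) => (1 : 𝔸ˣ)))
          (adTransportW φ fun _ : Bond d (towerP L m (n + 1)) => (1 : 𝔸ˣ)⁻¹) (principalOpK φ η fun _ => 1)
          (RofUk L m n φ η fun _ : Bond d (towerP L m (n + 1)) => (1 : 𝔸ˣ))
          (QkW L m n φ (fun _ : Bond d (towerP L m (n + 1)) => (1 : 𝔸ˣ)) hL (fun _ => 0) (fun _ => by norm_num)
            (perCfg_UlevOf_one_mem_U1 L m (n + 1)) (norm_Wcx_UlevOf_one_sub_one_le L m (n + 1) (fun _ => 0) fun _ => le_rfl)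
            (c₁ := c₁)) a x⟫_ℂ := by
  have hC : (1 : ℝ) ≤ B5Prop11Plancherel.Cst d a := B5Prop11Lower.one_le_Cst _
  refine ⟨1 / ((d + 1 : ℝ) * B5Prop11Plancherel.Cst d a), by positivity, fun L _ hL n η hηL0 hηL1 c₀ c₁ _ _ hs m _ x => ?_⟩
  exact flat_strong_coercive_tower_canonical L m n hL φ (c₁ := c₁) _ _ _ _ ha hηL0 hηL1 hs x

end CanonicalExists

/-! ## §2 μ_{1,(n+1)} of the tower, EXPLICIT: the block Poincaré modulus at block side `L^{n+1}η` -/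

section Modulus

variable {𝔸 : Type*} [NormedRing 𝔸] [NormedAlgebra ℂ 𝔸] [CompleteSpace 𝔸]
  (L : ℕ) [NeZero L] (m : Fin d → ℕ) [∀ i, NeZero (m i)] (n : ℕ)
  {W : Type*} [NormedAddCommGroup W] [InnerProductSpace ℂ W] [FiniteDimensional ℂ W] (φ : W ≃ₗ[ℂ] 𝔸) {c₀ : ℝ} [Fact (0 < c₀)]
  {η : ℝ} (hη : η ≠ 0)

include hη

/-- **(P3)_{n+1} THE EXPLICIT FLAT INJECTIVITY MODULUS OF THE TOWER: `(2∕((L^{n+1})²η²))·‖λ‖ ≤ ‖Δ^η_1 λ‖` ON `N(Q′_{n+1}(1))`** — ne9-leaf-04's one-step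
`B9Eq323FlatBlockPoincare.flat_modulus_explicit` AT BLOCK SIZE `L^{n+1}` carried along `B9Eq316TowerFlatIsOneStep` (`N(Q′_{n+1}(1)) = Φ′⁻¹N(Q′^{(L^{n+1})}(1))`,
`Δ^η_1 Φ′ = Φ′ Δ^η_1`, `Φ′` an isometry); replaces the compactness witness of `B9Thm311SmallFieldCoercivityTower.exists_flat_modulus_tower` — on the
diagonal `ηL^{n+1} = 1` the modulus is `2`, free of everything. [cite: Balaban1985BackgroundPropagators, (3.21)–(3.23) p.394, (3.19) p.393; Balaban1983RegularityDecay, (2.27) p.580; Balaban1984PropagatorsI, (1.18) p.20] -/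
theorem flat_modulus_tower_explicit (l : SiteL2K ℂ d (towerP L m (n + 1)) c₀ W)
    (hQ : QprimeTowerW L m n φ (fun _ : Bond d (towerP L m (n + 1)) => (1 : 𝔸ˣ)) (c₀ := c₀) l = 0) :
    2 / (((L : ℝ) ^ (n + 1)) ^ 2 * η ^ 2) * ‖l‖ ≤
      ‖covLaplaceSiteK ((η : ℂ))⁻¹ (adTransportW φ (fun _ : Bond d (towerP L m (n + 1)) => (1 : 𝔸ˣ)))
        (adTransportW φ fun _ : Bond d (towerP L m (n + 1)) => (1 : 𝔸ˣ)⁻¹) l‖ := by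
  have h := towerP_eq_fineP_pow L m (n + 1)
  have hQ' := (QprimeTowerW_one_eq_zero_iff L m n φ h l).1 hQ
  have key := flat_modulus_explicit (L ^ (n + 1)) m φ hη (siteL2Cast ℂ h l) hQ'
  rw [covLaplaceSiteK_one_siteL2Cast, norm_siteL2Cast, norm_siteL2Cast] at key
  simpa only [Nat.cast_pow] using key

/-- **`∃ μ` FORM with the explicit witness** — literally the statement of `B9Thm311SmallFieldCoercivityTower.exists_flat_modulus_tower`, now with
`μ := 2∕((L^{n+1})²η²)`. [cite: Balaban1985BackgroundPropagators, (3.21)–(3.23) p.394; Balaban1983RegularityDecay, (2.27) p.580] -/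
theorem exists_flat_modulus_tower_explicit :
    ∃ μ : ℝ, μ = 2 / (((L : ℝ) ^ (n + 1)) ^ 2 * η ^ 2) ∧ 0 < μ ∧ ∀ l : SiteL2K ℂ d (towerP L m (n + 1)) c₀ W,
      QprimeTowerW L m n φ (fun _ : Bond d (towerP L m (n + 1)) => (1 : 𝔸ˣ)) l = 0 →
        μ * ‖l‖ ≤ ‖covLaplaceSiteK ((η : ℂ))⁻¹ (adTransportW φ (fun _ : Bond d (towerP L m (n + 1)) => (1 : 𝔸ˣ)))
          (adTransportW φ fun _ : Bond d (towerP L m (n + 1)) => (1 : 𝔸ˣ)⁻¹) l‖ := by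
  have hL0 : (0 : ℝ) < L := by exact_mod_cast Nat.pos_of_ne_zero (NeZero.ne L)
  exact ⟨_, rfl, by positivity, fun l hQ => flat_modulus_tower_explicit L m n φ hη l hQ⟩

end Modulus

end Literature.MathematicalPhysics.QuantumFieldTheory.Balaban1983to89.B9Eq326OperatorTowerFlatExplicit

end
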